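import Mathlib
import HarnessLib
import Summits.KontsevichZagierPeriods.KontsevichZagierPeriods.Theses.FurushoPentagon
import Summits.KontsevichZagierPeriods.KontsevichZagierPeriods.Theorems.FurushoPentagonDoubleShuffleOfPentagon
import Summits.KontsevichZagierPeriods.KontsevichZagierPeriods.Theorems.PentagonInKZ.Negative.RulesAssociator
import Summits.KontsevichZagierPeriods.KontsevichZagierPeriods.Theorems.FurushoPentagonKernelModuloPeriodConjectureFormalHoffmanSpan
import Summits.KontsevichZagierPeriods.KontsevichZagierPeriods.Theorems.FurushoPentagonKernelModuloPeriodConjectureSectorKernelOfFormalSpan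
import Literature.NumberTheory.Transcendental.KZRulesAssociator

/-!
# `KernelModuloPeriodConjecture`, line `Sketch`: the MZV-sector transfer (glue)

Crux `FurushoPentagon.KernelModuloPeriodConjecture` (stmt-KontsevichZagierPeriods-15058), line
`Sketch`. This file composes the two landed theorem-grade stubs of the line,

* G1 `stub_formalHoffmanSpan` (`…FormalHoffmanSpan.lean`): `PentagonInKZ → ReducedPeriodRing →`
  algebraic leaf `→` every `1 ⊗ ⟦ζ(s)⟧` lies in the `ℚ`-span of the Hoffman classes in `P_ℚ`;
* G2 `stub_sectorKernelOfFormalSpan` (`…SectorKernelOfFormalSpan.lean`): formal Hoffman spanning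
  `→ MzvPeriodConjecture →` Conjecture 1 on the MZV sector,

into **the MZV-sector transfer** `mzvSectorKernel_of` — the support lemma asked for by the item
text of the crux and the glue `MzvSectorTransfer` of the route header's prepared glued split
`KernelModuloPeriodConjecture ⇐ AssociatorHoffmanSpanning → OffMzvSectorComplement`:

`PentagonInKZ → ReducedPeriodRing → AssociatorHoffmanSpanning → MzvPeriodConjecture →`
`∀ c ∈ ⟨[Δ_s, ∏ ω] : s admissible⟩, KZ.eval c = 0 → c ∈ KZ.relations`,

with the algebraic leaf `AssociatorHoffmanSpanning` (Hoffman words span `𝒪(GroupLike ∩ Pent)_red`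
weight by weight — the coordinate form of `GRT₁ ≅ U^{dR}_{MT(ℤ)}`, OPEN) spelled out as a
hypothesis, and records the by-product `generalisedDoubleShuffle_rulesAssociator`: under
`PentagonInKZ ∧ ReducedPeriodRing` the rules associator `Φ_P` satisfies Furusho's generalised double
shuffle relation (the route's proved mechanism `DoubleShuffleOfPentagon` read at the universal
realisation).

References: H. Furusho, Ann. of Math. 174 (2011), Thm 1.2 [Furusho2011]; F. Brown, Ann. of Math.
175 (2012), Thm 1.1 [Brown2012]; V. Drinfeld, Leningrad Math. J. 2 (1991) [Drinfeld1991];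
M. Kontsevich, D. Zagier, *Periods* (2001), §1.2, §4.1 [KontsevichZagier2001].
-/

noncomputable section

namespace Summit.KontsevichZagierPeriods.FurushoPentagon.KernelModuloPeriodConjecture

open Literature.NumberTheory.Transcendental
open Literature.NumberTheory.Transcendental.KZ
open Summit.KontsevichZagierPeriods.KontsevichZagierPeriods.Theses.FurushoPentagon
open Summit.KontsevichZagierPeriods.FurushoPentagon.PentagonInKZNegative
  (chiUniv isRealisation_chiUniv simplexZ simplexZ_agrees cruxSeries cruxSeries_chiUniv)
open Summit.KontsevichZagierPeriods.FurushoPentagon.DoubleShuffleOfPentagon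
  (doubleShuffleOfPentagon_proof)

/-- **T — the MZV-sector transfer `MzvSectorTransfer`** (registered stub `stub_mzvSectorTransfer`
of the line `Sketch` on crux stmt-KontsevichZagierPeriods-15058; glue of the prepared split of the
crux): `PentagonInKZ → ReducedPeriodRing → AssociatorHoffmanSpanning → MzvPeriodConjecture →`
Conjecture 1 in kernel form on the subgroup of `KZ.FormalRep` generated by the simplex classes of
the multiple zeta values. Composition of the landed stubs G1 (`stub_formalHoffmanSpan`) and G2
(`stub_sectorKernelOfFormalSpan`). [cite: Furusho2011, Thm 1.2] -/
theorem stub_mzvSectorTransfer :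
    PentagonInKZ → ReducedPeriodRing → (∀ s : List ℕ, MZV.IsAdmissible s → ∃ b : List ℕ →₀ ℚ, (∀ t ∈ b.support, MZV.IsHoffman t ∧ MZV.weight t = MZV.weight s) ∧ ∀ (R : Type) [CommRing R] [Algebra ℚ R] [IsReduced R] (φ : NCSeries Bool R), NCSeries.IsGroupLike φ → NCSeries.DrinfeldPentagon φ → φ (MZV.binaryWord s) = b.sum (fun t q => q • φ (MZV.binaryWord t))) → MzvPeriodConjecture → ∀ c ∈ AddSubgroup.closure (Set.range (fun s : {s : List ℕ // MZV.IsAdmissible s} => KZ.of (KZ.mzvRep s.1 s.2 (KZ.mzvIntegrand_isSemialgebraicFunOn_holds s.1) (KZ.mzvIntegrand_integrableOn_holds s.1 s.2)))), KZ.eval c = 0 → c ∈ KZ.relations :=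
  fun hP hR hA hZ => stub_sectorKernelOfFormalSpan (stub_formalHoffmanSpan hP hR hA) hZ

/-- **The MZV-sector transfer, curried** (the support lemma `mzvSectorKernel_of` asked for by the
item text of the crux): under `PentagonInKZ`, `ReducedPeriodRing`, the algebraic leaf and
`MzvPeriodConjecture`, every `ℤ`-combination of simplex classes `[Δ_s, ∏ ω_ε]` of value `0` is a
relation of the Kontsevich–Zagier calculus. [cite: Furusho2011, Thm 1.2] -/
theorem mzvSectorKernel_of (hP : PentagonInKZ) (hR : ReducedPeriodRing)
    (hA : ∀ s : List ℕ, MZV.IsAdmissible s → ∃ b : List ℕ →₀ ℚ, (∀ t ∈ b.support, MZV.IsHoffman t ∧ MZV.weight t = MZV.weight s) ∧ ∀ (R : Type) [CommRing R] [Algebra ℚ R] [IsReduced R] (φ : NCSeries Bool R), NCSeries.IsGroupLike φ → NCSeries.DrinfeldPentagon φ → φ (MZV.binaryWord s) = b.sum (fun t q => q • φ (MZV.binaryWord t)))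
    (hZ : MzvPeriodConjecture) :
    ∀ c ∈ AddSubgroup.closure (Set.range (fun s : {s : List ℕ // MZV.IsAdmissible s} => KZ.of (KZ.mzvRep s.1 s.2 (KZ.mzvIntegrand_isSemialgebraicFunOn_holds s.1) (KZ.mzvIntegrand_integrableOn_holds s.1 s.2)))), KZ.eval c = 0 → c ∈ KZ.relations :=
  stub_mzvSectorTransfer hP hR hA hZ

/-- **`Φ_P` satisfies the generalised double shuffle relation under `PentagonInKZ ∧
ReducedPeriodRing`**: the route's proved mechanism `DoubleShuffleOfPentagon` read at the universal
realisation `χ₀ : FormalRep → P_ℚ`, whose series is the rules associator (`cruxSeries_chiUniv`).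
[cite: Furusho2011, Thm 1.2] -/
theorem generalisedDoubleShuffle_rulesAssociator (hP : PentagonInKZ) (hR : ReducedPeriodRing) :
    NCSeries.GeneralisedDoubleShuffle KZ.rulesAssociator := by
  have h := doubleShuffleOfPentagon_proof hP hR KZ.FormalPeriodAlgebra chiUniv
    isRealisation_chiUniv.rel isRealisation_chiUniv.mul isRealisation_chiUniv.unit simplexZ
    simplexZ_agrees
  have h' : NCSeries.GeneralisedDoubleShuffle (cruxSeries KZ.FormalPeriodAlgebra chiUniv simplexZ) := h
  rwa [cruxSeries_chiUniv] at h'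

end Summit.KontsevichZagierPeriods.FurushoPentagon.KernelModuloPeriodConjecture

end
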